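import Literature.MathematicalPhysics.QuantumFieldTheory.Balaban1983to89.B8Lemma1NonAbelian

/-!
# `Balaban1983to89.B15TreeGauge196Walks` — T. Bałaban, *Large field renormalization. I. The basic step of the 𝐑 operation*, Commun. Math. Phys. **122** (1989) 175–202 [Balaban1989LargeFieldI], pp. 195–196 (the generalized axial gauge on `P₁ ∖ P₂`): PART 1/3 — bookkeeping on the vertices of lattice walks (`PathIn`) and on tree words over a list of directions (`restrict`, `disp_tw`, `pathIn_tw`), over the `ℤ^d` words of `B7Prop1Explicit` / `B8Lemma1NonAbelian`

statement-level skeleton of published theorems with citation tags; proofs where landed; nothing here is a claim about the Yang–Mills mass gap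

PDF held: `paper:balaban1989-cmp122-large-field-i` (journal page = PDF page + 174; pp. 195–196 = PDF pp. 21–22, re-read
AS IMAGES: `run/shared/lean/pub/pub-balaban/b2b-balaban-ref1/pages/1989-cmp122-large-field-I/…-p021-x2.png`,
`…-p022-x2.png`).

WHAT IS REPRODUCED.  Nothing printed is typed in this part: it is the bookkeeping vocabulary needed to say *"the contour
Γ_{y,x} lies in P₁ ∖ P₂"* (p. 196: "The union of all the contours is a tree graph T on P₁∖P₂") for contours spelled
as WORDS (`B7Prop1Explicit.hol`, `seg`, `treeWord`; `B8Lemma1NonAbelian.tw`): `PathIn S p w` (every vertex of the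
walk `w` from `p` is in `S`) with its calculus (`pathIn_append`, `pathIn_seg_natCast`, `pathIn_seg_neg`), and for tree
words `tw ks v`: the displacement `disp_tw` (= `restrict ks v`), the length `length_tw(_le)`, the directions of the
letters `fst_mem_of_mem_tw`, and `pathIn_tw` (the vertices lie in the order interval `[p, p + restrict ks v]`).  The
contours themselves are PART 2 (`B15TreeGauge196`), the annulus lemma PART 3 (`B15TreeGauge196Annulus`); all three
parts share the namespace `B15TreeGauge196`.  They serve the case-1 estimate of [Balaban1989LargeFieldII] p. 382
(SKELETON row `B16.Lem@381`, files `B16Ineq382Stokes`, `B16Ineq382TreeGauge`).  Mega-formalization `lit-balaban`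
(HOME `run/shared/lean/pub/lit-balaban/`), Phase-2 seat p26, generation 2; every declaration here is a definition with
a body or a proved lemma; no measure, no claim of [IV]/[V] is asserted.  Unit `lit-balaban-p26`
(literature-prover-lit-balaban-p26-g2-0).
-/

noncomputable section

open scoped BigOperators

namespace Literature.MathematicalPhysics.QuantumFieldTheory.Balaban1983to89.B15TreeGauge196

open B7Prop1Explicit B8Lemma1NonAbelian

-- `Site` alone would resolve to the torus sites of `Setup.lean`: re-export the `ℤ^d` sites (as `B8Lemma1NonAbelian`).
export B7Prop1Explicit (Site)

variable {d : ℕ}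

/-! ## §1 Vertices of lattice walks (bookkeeping for "the contour lies in `P₁ ∖ P₂`") -/

section Walks

/-- Every vertex `p + disp w₁` (`w₁` a prefix of `w`) of the walk spelled by the word `w` from `p` lies in `S`. [cite: Balaban1989LargeFieldI, p.196] -/
def PathIn (S : Set (Site d)) (p : Site d) (w : List (Letter d)) : Prop :=
  ∀ w₁ w₂ : List (Letter d), w = w₁ ++ w₂ → p + disp w₁ ∈ S

variable {S T : Set (Site d)} {p : Site d}

/-- The starting point of a walk in `S` is in `S`. [cite: Balaban1989LargeFieldI, p.196] -/
theorem PathIn.start {w : List (Letter d)} (h : PathIn S p w) : p ∈ S := by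
  simpa using h [] w rfl

/-- The end point of a walk in `S` is in `S`. [cite: Balaban1989LargeFieldI, p.196] -/
theorem PathIn.finish {w : List (Letter d)} (h : PathIn S p w) : p + disp w ∈ S := by
  simpa using h w [] (by simp)

/-- `PathIn` is monotone in the set. [cite: Balaban1989LargeFieldI, p.196] -/
theorem PathIn.mono (hST : S ⊆ T) {w : List (Letter d)} (h : PathIn S p w) : PathIn T p w :=
  fun w₁ w₂ hw => hST (h w₁ w₂ hw)

/-- The empty walk. [cite: Balaban1989LargeFieldI, p.196] -/
theorem pathIn_nil : PathIn S p [] ↔ p ∈ S := by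
  refine ⟨fun h => h.start, fun hp w₁ w₂ hw => ?_⟩
  have : w₁ = [] := (List.append_eq_nil_iff.mp hw.symm).1
  subst this; simpa using hp

/-- One step. [cite: Balaban1989LargeFieldI, p.196] -/
theorem pathIn_cons {l : Letter d} {w : List (Letter d)} :
    PathIn S p (l :: w) ↔ p ∈ S ∧ PathIn S (p + l.vec) w := by
  constructor
  · intro h
    refine ⟨h.start, fun w₁ w₂ hw => ?_⟩
    have := h (l :: w₁) w₂ (by rw [hw]; rfl)
    simpa [add_assoc] using this
  · rintro ⟨hp, h⟩ w₁ w₂ hw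
    cases w₁ with
    | nil => simpa using hp
    | cons l' w₁ =>
      simp only [List.cons_append, List.cons.injEq] at hw
      obtain ⟨rfl, hw⟩ := hw
      have := h w₁ w₂ hw
      simpa [add_assoc] using this

/-- Concatenation of walks. [cite: Balaban1989LargeFieldI, p.196] -/
theorem pathIn_append {u u' : List (Letter d)} :
    PathIn S p (u ++ u') ↔ PathIn S p u ∧ PathIn S (p + disp u) u' := by
  induction u generalizing p with
  | nil =>
    simp only [List.nil_append, disp_nil, add_zero]
    exact ⟨fun h => ⟨pathIn_nil.mpr h.start, h⟩, fun h => h.2⟩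
  | cons l u ih => rw [List.cons_append, pathIn_cons, pathIn_cons, ih, disp_cons, ← add_assoc, and_assoc]

/-- A forward straight segment `[p, p + m e_κ]`: its vertices are `p + j e_κ`, `0 ≤ j ≤ m`. [cite: Balaban1989LargeFieldI, p.196] -/
theorem pathIn_seg_natCast {κ : Fin d} {m : ℕ} :
    PathIn S p (seg κ (m : ℤ)) ↔ ∀ j : ℕ, j ≤ m → p + (j : ℤ) • e κ ∈ S := by
  induction m generalizing p with
  | zero =>
    rw [Nat.cast_zero, seg_zero, pathIn_nil]
    exact ⟨fun h j hj => by rw [Nat.le_zero.mp hj]; simpa using h, fun h => by simpa using h 0 le_rfl⟩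
  | succ m ih =>
    have hs : seg κ ((m + 1 : ℕ) : ℤ) = (κ, true) :: seg κ (m : ℤ) := by
      rw [seg_natCast, seg_natCast, List.replicate_succ]
    rw [hs, pathIn_cons, ih, Letter.vec_true]
    constructor
    · rintro ⟨hp, h⟩ j hj
      rcases Nat.eq_zero_or_pos j with rfl | hj0
      · simpa using hp
      · obtain ⟨j', rfl⟩ : ∃ j', j = j' + 1 := ⟨j - 1, by omega⟩
        have := h j' (by omega)
        rw [add_assoc, add_comm (e κ) _] at this
        rwa [Nat.cast_succ, add_zsmul, one_zsmul]
    · intro h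
      refine ⟨by simpa using h 0 (Nat.zero_le _), fun j hj => ?_⟩
      have := h (j + 1) (by omega)
      rwa [Nat.cast_succ, add_zsmul, one_zsmul, add_comm ((j : ℤ) • e κ) _, ← add_assoc] at this

/-- A backward straight segment `[p, p − m e_κ]`: its vertices are `p − j e_κ`, `0 ≤ j ≤ m`. [cite: Balaban1989LargeFieldI, p.196] -/
theorem pathIn_seg_neg {κ : Fin d} {m : ℕ} :
    PathIn S p (seg κ (-(m : ℤ))) ↔ ∀ j : ℕ, j ≤ m → p - (j : ℤ) • e κ ∈ S := by
  induction m generalizing p with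
  | zero =>
    rw [Nat.cast_zero, neg_zero, seg_zero, pathIn_nil]
    exact ⟨fun h j hj => by rw [Nat.le_zero.mp hj]; simpa using h, fun h => by simpa using h 0 le_rfl⟩
  | succ m ih =>
    have hs : seg κ (-((m + 1 : ℕ) : ℤ)) = (κ, false) :: seg κ (-(m : ℤ)) := by
      rw [seg_neg_natCast, seg_neg_natCast, List.replicate_succ]
    rw [hs, pathIn_cons, ih, Letter.vec_false, ← sub_eq_add_neg]
    constructor
    · rintro ⟨hp, h⟩ j hj
      rcases Nat.eq_zero_or_pos j with rfl | hj0
      · simpa using hp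
      · obtain ⟨j', rfl⟩ : ∃ j', j = j' + 1 := ⟨j - 1, by omega⟩
        have := h j' (by omega)
        rw [sub_sub, add_comm (e κ) _] at this
        rwa [Nat.cast_succ, add_zsmul, one_zsmul]
    · intro h
      refine ⟨by simpa using h 0 (Nat.zero_le _), fun j hj => ?_⟩
      have := h (j + 1) (by omega)
      rwa [Nat.cast_succ, add_zsmul, one_zsmul, ← sub_sub, sub_right_comm] at this

/-- The coordinates listed in `ks` are taken from `v`, the others are `0`. [cite: Balaban1989LargeFieldI, p.196] -/
def restrict (ks : List (Fin d)) (v : Site d) : Site d := fun κ => if κ ∈ ks then v κ else 0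

/-- `restrict_nil` — bookkeeping. [cite: Balaban1989LargeFieldI, p.196] -/
@[simp] theorem restrict_nil (v : Site d) : restrict [] v = 0 := by
  funext κ; simp [restrict]

/-- `restrict_cons` — bookkeeping (no repeated direction). [cite: Balaban1989LargeFieldI, p.196] -/
theorem restrict_cons {κ : Fin d} {ks : List (Fin d)} (h : κ ∉ ks) (v : Site d) :
    restrict (κ :: ks) v = v κ • e κ + restrict ks v := by
  funext κ'
  simp only [restrict, List.mem_cons, Pi.add_apply, zsmul_e_apply]
  by_cases h1 : κ' = κ
  · subst h1; simp [h]
  · simp [h1]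

/-- `restrict_apply_of_mem` — bookkeeping. [cite: Balaban1989LargeFieldI, p.196] -/
theorem restrict_apply_of_mem {ks : List (Fin d)} {κ : Fin d} (h : κ ∈ ks) (v : Site d) :
    restrict ks v κ = v κ := if_pos h

/-- `restrict_apply_of_not_mem` — bookkeeping. [cite: Balaban1989LargeFieldI, p.196] -/
theorem restrict_apply_of_not_mem {ks : List (Fin d)} {κ : Fin d} (h : κ ∉ ks) (v : Site d) :
    restrict ks v κ = 0 := if_neg h

/-- `tw_append` — bookkeeping: tree words over a concatenated list of directions. [cite: Balaban1989LargeFieldI, p.196] -/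
theorem tw_append (ks ks' : List (Fin d)) (v : Site d) : tw (ks ++ ks') v = tw ks v ++ tw ks' v := by
  simp [tw, List.flatMap_append]

/-- The displacement of a tree word: the listed coordinates of `v`. [cite: Balaban1989LargeFieldI, p.196] -/
theorem disp_tw {ks : List (Fin d)} (hnd : ks.Nodup) (v : Site d) : disp (tw ks v) = restrict ks v := by
  induction ks with
  | nil => simp
  | cons κ ks ih =>
    have hκ : κ ∉ ks := (List.nodup_cons.mp hnd).1
    rw [tw_cons, disp_append, disp_seg, ih (List.nodup_cons.mp hnd).2, restrict_cons hκ]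

/-- The length of a tree word. [cite: Balaban1989LargeFieldI, p.196] -/
theorem length_tw (ks : List (Fin d)) (v : Site d) :
    (tw ks v).length = (ks.map fun κ => (v κ).natAbs).sum := by
  induction ks with
  | nil => simp
  | cons κ ks ih => rw [tw_cons, List.length_append, length_seg, ih, List.map_cons, List.sum_cons]

/-- The length of a tree word is at most `|ks| · W` if every listed coordinate of `v` is at most `W` in size. [cite: Balaban1989LargeFieldI, p.196] -/
theorem length_tw_le {ks : List (Fin d)} {v : Site d} {W : ℕ} (h : ∀ κ ∈ ks, (v κ).natAbs ≤ W) :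
    (tw ks v).length ≤ ks.length * W := by
  induction ks with
  | nil => simp
  | cons κ ks ih =>
    rw [tw_cons, List.length_append, length_seg, List.length_cons, Nat.succ_mul]
    have h1 := h κ (by simp)
    have h2 := ih (fun κ' hκ' => h κ' (List.mem_cons_of_mem κ hκ'))
    omega

/-- The letters of a tree word have directions in the list. [cite: Balaban1989LargeFieldI, p.196] -/
theorem fst_mem_of_mem_tw {ks : List (Fin d)} {v : Site d} {l : Letter d} (h : l ∈ tw ks v) : l.1 ∈ ks := by
  induction ks with
  | nil => simp at h
  | cons κ ks ih =>
    rw [tw_cons, List.mem_append] at h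
    rcases h with h | h
    · rw [mem_seg h]; simp
    · exact List.mem_cons_of_mem κ (ih h)

/-- **The vertices of a tree word** over a list of directions without repetition, for a vector `v` non-negative in
the listed coordinates, lie in the order interval `[p, p + restrict ks v]`. [cite: Balaban1989LargeFieldI, p.196] -/
theorem pathIn_tw (ks : List (Fin d)) (hnd : ks.Nodup) (v : Site d) (hv : ∀ κ ∈ ks, 0 ≤ v κ) (p : Site d)
    (hS : ∀ z : Site d, p ≤ z → z ≤ p + restrict ks v → z ∈ S) : PathIn S p (tw ks v) := by
  induction ks generalizing p with
  | nil => rw [tw_nil, pathIn_nil]; exact hS p le_rfl (by simp)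
  | cons κ ks ih =>
    have hκ : κ ∉ ks := (List.nodup_cons.mp hnd).1
    have hnd' : ks.Nodup := (List.nodup_cons.mp hnd).2
    obtain ⟨m, hm⟩ := Int.eq_ofNat_of_zero_le (hv κ (by simp))
    have hrest : ∀ κ', 0 ≤ restrict ks v κ' := fun κ' => by
      by_cases h' : κ' ∈ ks
      · rw [restrict_apply_of_mem h']; exact hv κ' (List.mem_cons_of_mem κ h')
      · rw [restrict_apply_of_not_mem h']
    rw [tw_cons, pathIn_append, disp_seg, hm]
    constructor
    · rw [pathIn_seg_natCast]
      intro j hj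
      refine hS _ (le_add_of_nonneg_right (zsmul_e_nonneg (by positivity) κ)) ?_
      rw [restrict_cons hκ, ← add_assoc]
      refine le_trans ?_ (le_add_of_nonneg_right fun κ' => hrest κ')
      refine add_le_add le_rfl fun κ' => ?_
      simp only [zsmul_e_apply]
      split_ifs
      · rw [hm]; exact_mod_cast hj
      · exact le_rfl
    · refine ih hnd' (fun κ' hκ' => hv κ' (List.mem_cons_of_mem κ hκ')) _ fun z hz1 hz2 => hS z ?_ ?_
      · exact le_trans (le_add_of_nonneg_right (zsmul_e_nonneg (by positivity) κ)) hz1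
      · rw [restrict_cons hκ, ← add_assoc, hm]; exact hz2

end Walks

end Literature.MathematicalPhysics.QuantumFieldTheory.Balaban1983to89.B15TreeGauge196
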